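import Summits.BirchSwinnertonDyer.BirchSwinnertonDyer.Theorems.GenusKolyvaginAtTwoPowDvdShaCardAtTwoRTOrderFourAuxiliaryConstrained
import HarnessLib

/-!
# Route `GenusKolyvaginAtTwo`, crux L_T `PowDvdShaCardAtTwoRT` (stmt-BirchSwinnertonDyer-23242), LINE 18 stub L, bottom rung:
# THE AUXILIARY CLASS AVOIDING A PRESCRIBED FINITE SET OF CLASSES (the Lawson–Wuthrich phantom at level 4) —
# `∃ y ∈ 𝒴, 2•y ∉ B` as soon as `#B · 8^{#T} < ∏_u #M_u`, e.g. `#B < 2^{#free places}`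

Width seat `bsd-line-gk2-p4` g18 (cell `bsd-f1-sign2`), `--supports 23242 --as helper`.  THEOREMS ONLY (no definition, no named fact,
no `sorry`; standard axioms).  BSD is NOT proved by any of this; neither is the crux nor stub L.

WHY (LEAD memo `Cruxes/PowDvdShaCardAtTwoRT/Lines/plus-descent-lead-g16.md` §11 finding (B), STATUS 07:12:27Z).  The `ℓ′`-term of the
bottom-rung reciprocity is non-zero only if the auxiliary `y` has `loc_{ℓ′} y` of order `4`, supplied by Čebotarev — impossible when
`2•y` is the LW PHANTOM `φ₄ ∈ H¹(ℚ(E[4])/ℚ, E[4]) ≅ ℤ/2`, which dies at every level-`4` Kolyvagin prime.  So the auxiliary must be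
chosen with `2•y ∉ {0, φ₄}` («free by counting when `k ≥ 2`», LEAD).  This file is that counting, in the generality of the LEAD's
two-level lemma: for ANY finite set `B` of classes, if every `y` of the solution group `Y₄` had `q•y ∈ B` then `#Y₄ ≤ #B · #Y₂`
(the fibres of `y ↦ q•y` are cosets of `Y₄[q] ⊆ ι Y₂`), so the two relaxed counts give a contradiction as soon as
`#B · m₂ · g₄ < m₄ · g₂` — the LEAD's `exists_nsmul_ne_zero_of_counts` (p697101) is the case `B = {0}`.
* §1 `natCard_le_card_mul_of_forall_nsmul_mem`, **`exists_nsmul_not_mem_of_counts`** (abstract, any `q`, any `B`).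
* §2 **`exists_mem_solutions_nsmul_not_mem_canonical`** — the canonical-family instance (two levels `p^{k₂}`, `p^{k₄}`, displayed level
  map, ANY conditions `M_u`, numerics `#B² · ∏#H¹(K_u,E[p^{k₂}]) · ∏#H¹(K_u,E[p^{k₄}]) < (∏ #M_u)²`): `∃ y ∈ 𝒴, q•y ∉ B`
  (the LEAD's `exists_mem_solutions_nsmul_ne_zero_canonical` re-run with the factor `#B`).
* (sequel `…RTOrderFourAuxiliaryAvoidingRat`: the level-`4` instance over `ℚ` at Gross–Kolyvagin primes, `#B · 8^{#T} < ∏ #M_u`, i.e.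
  `#B < 2^{#free places}` — for `B = {0, φ₄}` two free places, finding (B) for `k ≥ 2`.)
HONEST FRAMING: bookkeeping over p697101 / p697543 / p698989 (tree theorems); whether `φ₄` is Kummer off `T` (the `k = 1` case) is NOT
addressed; closes nothing.  BSD is NOT proved by any of this.

References: [McCallumLMS1991] §2 Prop. 2.1, §5 proof of Prop. 5.2; [MilneADT2006] Ch. I Thm. 2.8, Thm. 2.13, Thm. 4.10;
[LawsonWuthrich2016] (vanishing of `H¹(Gal(ℚ(E[2^k])/ℚ), E[2^k])` and its failure at `2`).
-/

set_option autoImplicit false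
-- the Theorems namespace of this sub repeats the summit name by design (D-0017 nested layout)
set_option linter.dupNamespace false

noncomputable section

open scoped Classical

open CategoryTheory Field NumberField IsDedekindDomain Function
open _root_.WeierstrassCurve
open Literature.NumberTheory.EllipticCurves
open Literature.NumberTheory.GaloisRepresentations
open Literature.NumberTheory.GaloisCohomology
open Summit.BirchSwinnertonDyer.Rank1Residual.X11b.KummerPT
open Summit.BirchSwinnertonDyer.Rank1Residual.X11b.FiniteDuality
open Summit.BirchSwinnertonDyer.Rank1Residual.X11b.Relaxation
open Summit.BirchSwinnertonDyer.Rank1Residual.X11b.LocBridge Summit.BirchSwinnertonDyer.Rank1Residual.X11b.Levels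
open Summit.BirchSwinnertonDyer.Rank1Residual.X11b.AcSelmer
open scoped ContRepresentation

namespace Summit.BirchSwinnertonDyer.BirchSwinnertonDyer.Theorems.GenusExact.RelaxedCount

open Summit.BirchSwinnertonDyer.BirchSwinnertonDyer.Theorems.GenusKolyKramer (finite_galoisCohomology_toLocal)
open Summit.BirchSwinnertonDyer.BirchSwinnertonDyer.Theorems.GenusExact.AuxiliaryClass
open Summit.BirchSwinnertonDyer.BirchSwinnertonDyer.Theorems.GenusExact.ReductionCyclic
open Summit.BirchSwinnertonDyer.BirchSwinnertonDyer.Theorems.GenusExact.LocalDualityOrder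

/-! ## §1 The two-level lemma avoiding a finite set -/

section Abstract

/-- **`#Y₄ ≤ #B · #Y₂` when every `y ∈ Y₄` has `q•y ∈ B`** (`Y₄[q] ⊆ ι Y₂`, `ι` injective): the fibres of `y ↦ q•y` on `Y₄` are cosets
of `Y₄[q]`. [folklore] -/
theorem natCard_le_card_mul_of_forall_nsmul_mem {W₂ : Type*} [AddCommGroup W₂] {W₄ : Type*} [AddCommGroup W₄] (q : ℕ)
    (ι : W₂ →+ W₄) (Y₄ : AddSubgroup W₄) (Y₂ : AddSubgroup W₂) [Finite Y₂] [Finite Y₄]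
    (htors : ∀ y ∈ Y₄, q • y = 0 → y ∈ Y₂.map ι) (B : Finset W₄) (hB : ∀ y ∈ Y₄, q • y ∈ B) :
    Nat.card Y₄ ≤ B.card * Nat.card Y₂ := by
  classical
  set φ : Y₄ →+ W₄ := (nsmulAddMonoidHom q : W₄ →+ W₄).comp Y₄.subtype with hφ
  have hφapply : ∀ y : Y₄, φ y = q • (y : W₄) := fun y ↦ rfl
  -- `#Y₄ = #range · #ker`
  have hmul : Nat.card φ.ker * Nat.card φ.range = Nat.card Y₄ := by
    rw [← AddSubgroup.index_ker φ]; exact AddSubgroup.card_mul_index φ.ker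
  -- `#range ≤ #B`
  have hrange : Nat.card φ.range ≤ B.card := by
    have hsub : (φ.range : Set W₄) ⊆ (B : Set W₄) := by
      rintro _ ⟨y, rfl⟩
      exact hB y y.2
    calc Nat.card φ.range = Nat.card ↥(φ.range : Set W₄) := rfl
      _ ≤ Nat.card ↥(B : Set W₄) := Nat.card_mono (B : Set W₄).toFinite hsub
      _ = B.card := by simp only [Finset.coe_sort_coe, Nat.card_eq_fintype_card, Fintype.card_coe]
  -- `#ker ≤ #Y₂`
  haveI : Finite ↥(Y₂.map ι) := Finite.of_surjective _ (AddMonoidHom.addSubgroupMap_surjective ι Y₂)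
  have hker : Nat.card φ.ker ≤ Nat.card Y₂ := by
    have hinj : Injective (fun y : φ.ker ↦ (⟨((y : Y₄) : W₄), htors _ (y : Y₄).2 (by
        have h := y.2; rwa [AddMonoidHom.mem_ker, hφapply] at h)⟩ : Y₂.map ι)) := by
      intro a b h
      apply Subtype.ext; apply Subtype.ext
      exact congrArg (fun z : Y₂.map ι ↦ (z : W₄)) h
    calc Nat.card φ.ker ≤ Nat.card ↥(Y₂.map ι) := Nat.card_le_card_of_injective _ hinj
      _ ≤ Nat.card Y₂ := Nat.card_le_card_of_surjective _ (AddMonoidHom.addSubgroupMap_surjective ι Y₂)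
  calc Nat.card Y₄ = Nat.card φ.ker * Nat.card φ.range := hmul.symm
    _ ≤ Nat.card Y₂ * B.card := Nat.mul_le_mul hker hrange
    _ = B.card * Nat.card Y₂ := mul_comm _ _

/-- **Two-level lemma avoiding a finite set `B`**: `#Y₄·g₄ = m₄·#Y₄*`, `#Y₂·g₂ = m₂·#Y₂*`, `Y₄[q] ⊆ ι(Y₂)`, `ι(Y₂*) ⊆ Y₄*`,
`#B · m₂ · g₄ < m₄ · g₂` ⟹ **`∃ y ∈ Y₄, q•y ∉ B`** (`B = {0}`: the LEAD's `exists_nsmul_ne_zero_of_counts`). [folklore] -/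
theorem exists_nsmul_not_mem_of_counts {W₂ : Type*} [AddCommGroup W₂] {W₄ : Type*} [AddCommGroup W₄] (q : ℕ)
    (ι : W₂ →+ W₄) (hι : Injective ι) (Y₄ Y₄' : AddSubgroup W₄) (Y₂ Y₂' : AddSubgroup W₂) [Finite Y₂] [Finite Y₄'] [Finite Y₄]
    {g₂ g₄ m₂ m₄ : ℕ} (h4 : Nat.card Y₄ * g₄ = m₄ * Nat.card Y₄') (h2 : Nat.card Y₂ * g₂ = m₂ * Nat.card Y₂')
    (htors : ∀ y ∈ Y₄, q • y = 0 → y ∈ Y₂.map ι) (hdual : Y₂'.map ι ≤ Y₄') (B : Finset W₄)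
    (hlt : B.card * m₂ * g₄ < m₄ * g₂) :
    ∃ y ∈ Y₄, q • y ∉ B := by
  by_contra hne
  push Not at hne
  have hle : Nat.card Y₄ ≤ B.card * Nat.card Y₂ := natCard_le_card_mul_of_forall_nsmul_mem q ι Y₄ Y₂ htors B hne
  have hle' : Nat.card Y₂' ≤ Nat.card Y₄' := by
    calc Nat.card Y₂' = Nat.card ↥(Y₂'.map ι) := Nat.card_congr (Y₂'.equivMapOfInjective ι hι).toEquiv
      _ ≤ Nat.card Y₄' := AddSubgroup.card_le_of_le hdual
  have hpos : 0 < Nat.card Y₄' := Nat.card_pos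
  have key : Nat.card Y₄ * g₄ * g₂ < Nat.card Y₄ * g₄ * g₂ := by
    calc Nat.card Y₄ * g₄ * g₂ ≤ B.card * Nat.card Y₂ * g₂ * g₄ := by
          rw [mul_right_comm (Nat.card Y₄)]; exact Nat.mul_le_mul_right _ (Nat.mul_le_mul_right _ hle)
      _ = B.card * m₂ * g₄ * Nat.card Y₂' := by rw [mul_assoc B.card, h2]; ring
      _ ≤ B.card * m₂ * g₄ * Nat.card Y₄' := Nat.mul_le_mul_left _ hle'
      _ < m₄ * g₂ * Nat.card Y₄' := Nat.mul_lt_mul_of_pos_right hlt hpos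
      _ = Nat.card Y₄ * g₄ * g₂ := by rw [mul_right_comm, ← h4]
  exact lt_irrefl _ key

end Abstract

/-! ## §2 The canonical Kummer instance -/

section TwoLevel

variable {K : Type} [Field K] [NumberField K] (W : WeierstrassCurve K) [W.IsElliptic] (p : ℕ) [Fact p.Prime]
variable (k₂ k₄ : ℕ)
variable (e₂ : W.geomTorsion ((p ^ k₂ : ℕ) : ℤ) → W.geomTorsion ((p ^ k₂ : ℕ) : ℤ) → AlgebraicClosure K)
  (hμ₂ : ∀ S T, e₂ S T ^ (p ^ k₂) = 1)
  (hadd₁₂ : ∀ S₁ S₂ T, e₂ (S₁ + S₂) T = e₂ S₁ T * e₂ S₂ T)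
  (hadd₂₂ : ∀ S T₁ T₂, e₂ S (T₁ + T₂) = e₂ S T₁ * e₂ S T₂)
  (hgal₂ : ∀ (σ : absoluteGaloisGroup K) (S T : W.geomTorsion ((p ^ k₂ : ℕ) : ℤ)), σ • e₂ S T = e₂ (σ • S) (σ • T))
  (halt₂ : ∀ T, e₂ T T = 1) (hnondeg₂ : ∀ T, (∀ S, e₂ S T = 1) → T = 0)
variable (e₄ : W.geomTorsion ((p ^ k₄ : ℕ) : ℤ) → W.geomTorsion ((p ^ k₄ : ℕ) : ℤ) → AlgebraicClosure K)
  (hμ₄ : ∀ S T, e₄ S T ^ (p ^ k₄) = 1)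
  (hadd₁₄ : ∀ S₁ S₂ T, e₄ (S₁ + S₂) T = e₄ S₁ T * e₄ S₂ T)
  (hadd₂₄ : ∀ S T₁ T₂, e₄ S (T₁ + T₂) = e₄ S T₁ * e₄ S T₂)
  (hgal₄ : ∀ (σ : absoluteGaloisGroup K) (S T : W.geomTorsion ((p ^ k₄ : ℕ) : ℤ)), σ • e₄ S T = e₄ (σ • S) (σ • T))
  (halt₄ : ∀ T, e₄ T T = 1) (hnondeg₄ : ∀ T, (∀ S, e₄ S T = 1) → T = 0)

include halt₂ hnondeg₂ halt₄ hnondeg₄ hμ₂ hadd₁₂ hadd₂₂ hgal₂ hμ₄ hadd₁₄ hadd₂₄ hgal₄ in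
/-- **The auxiliary class avoiding a finite set `B` (two-level count, canonical Poitou–Tate family).**  Setting of the LEAD's
`exists_mem_solutions_nsmul_ne_zero_canonical` (levels `p^{k₂}`, `p^{k₄}`, displayed level map `ι`, ANY conditions `M_u` on `T`), a
finite set `B ⊆ H¹(K, E[p^{k₄}])`, and the numerical hypothesis **`#B² · ∏_u #H¹(K_u,E[p^{k₂}]) · ∏_u #H¹(K_u,E[p^{k₄}]) < (∏_u #M_u)²`**:
then the solution group `𝒴 = H¹_{𝓛,⊤ on T} ⊓ loc⁻¹(Π M_u)` contains `y` with **`q•y ∉ B`**. [cite: McCallumLMS1991, §2 Prop. 2.1 and §5 proof of Prop. 5.2]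
[cite: MilneADT2006, Ch. I, Thm. 2.8, Thm. 2.13 and Thm. 4.10] -/
theorem exists_mem_solutions_nsmul_not_mem_canonical (hk₂ : 0 < k₂) (hk₄ : 0 < k₄) (q : ℕ) (T : Finset (Place K))
    (loc₂ : galoisCohomology (W.torsionGaloisModule ((p ^ k₂ : ℕ) : ℤ)) 1 →+
      (∀ u : ↥T, galoisCohomology ((W.torsionGaloisModule ((p ^ k₂ : ℕ) : ℤ)).toLocal (u : Place K)) 1))
    (hloc₂ : ∀ c u, loc₂ c u = galoisCohomology.localization (W.torsionGaloisModule ((p ^ k₂ : ℕ) : ℤ)) (u : Place K) 1 c)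
    (loc₄ : galoisCohomology (W.torsionGaloisModule ((p ^ k₄ : ℕ) : ℤ)) 1 →+
      (∀ u : ↥T, galoisCohomology ((W.torsionGaloisModule ((p ^ k₄ : ℕ) : ℤ)).toLocal (u : Place K)) 1))
    (hloc₄ : ∀ c u, loc₄ c u = galoisCohomology.localization (W.torsionGaloisModule ((p ^ k₄ : ℕ) : ℤ)) (u : Place K) 1 c)
    (ι : galoisCohomology (W.torsionGaloisModule ((p ^ k₂ : ℕ) : ℤ)) 1 →+
      galoisCohomology (W.torsionGaloisModule ((p ^ k₄ : ℕ) : ℤ)) 1)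
    (hι : Injective ι)
    (hKO : ∀ c ∈ kummerOutside W (p ^ k₂) T, ι c ∈ kummerOutside W (p ^ k₄) T)
    (htors : ∀ y ∈ kummerOutside W (p ^ k₄) T, q • y = 0 → ∃ c ∈ kummerOutside W (p ^ k₂) T, ι c = y)
    (hloc0 : ∀ c (u : ↥T), loc₂ c u = 0 → loc₄ (ι c) u = 0)
    (M : ∀ u : ↥T, AddSubgroup (galoisCohomology ((W.torsionGaloisModule ((p ^ k₄ : ℕ) : ℤ)).toLocal (u : Place K)) 1))
    (B : Finset (galoisCohomology (W.torsionGaloisModule ((p ^ k₄ : ℕ) : ℤ)) 1))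
    (hlt : B.card ^ 2 *
        ((∏ u : ↥T, Nat.card (galoisCohomology ((W.torsionGaloisModule ((p ^ k₂ : ℕ) : ℤ)).toLocal (u : Place K)) 1)) *
        (∏ u : ↥T, Nat.card (galoisCohomology ((W.torsionGaloisModule ((p ^ k₄ : ℕ) : ℤ)).toLocal (u : Place K)) 1))) <
      (∏ u : ↥T, Nat.card (M u)) ^ 2) :
    ∃ y ∈ kummerOutside W (p ^ k₄) T ⊓ (AddSubgroup.pi Set.univ M).comap loc₄, q • y ∉ B := by
  classical
  have hprime : p.Prime := Fact.out
  haveI : NeZero (p ^ k₂) := ⟨pow_ne_zero _ hprime.ne_zero⟩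
  haveI : NeZero (p ^ k₄) := ⟨pow_ne_zero _ hprime.ne_zero⟩
  haveI hfin₂T : Finite (W.geomTorsion ((p ^ k₂ : ℕ) : ℤ)) := finite_geomTorsion_pow W p k₂
  haveI hfin₄T : Finite (W.geomTorsion ((p ^ k₄ : ℕ) : ℤ)) := finite_geomTorsion_pow W p k₄
  haveI hfin₂ : ∀ u : ↥T, Finite (galoisCohomology ((W.torsionGaloisModule ((p ^ k₂ : ℕ) : ℤ)).toLocal (u : Place K)) 1) :=
    fun u ↦ finite_galoisCohomology_toLocal W (p ^ k₂) u
  haveI hfin₄ : ∀ u : ↥T, Finite (galoisCohomology ((W.torsionGaloisModule ((p ^ k₄ : ℕ) : ℤ)).toLocal (u : Place K)) 1) :=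
    fun u ↦ finite_galoisCohomology_toLocal W (p ^ k₄) u
  -- the canonical inputs at both levels
  have hpp₂ : IsPrimePow (p ^ k₂) := ⟨p, k₂, hprime.prime, hk₂, rfl⟩
  have hpp₄ : IsPrimePow (p ^ k₄) := ⟨p, k₄, hprime.prime, hk₄, rfl⟩
  have hperf₂ := LocalInvariants.canonical_isPerfect (K := K) (n := p ^ k₂)
  have hperf₄ := LocalInvariants.canonical_isPerfect (K := K) (n := p ^ k₄)
  have hsum₂ := Summit.BirchSwinnertonDyer.BirchSwinnertonDyer.Theorems.SchneiderFreeAdditiveX3.PoitouTateReduction.sumLocalTermEqZero_canonical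
    (K := K) (p ^ k₂)
  have hsum₄ := Summit.BirchSwinnertonDyer.BirchSwinnertonDyer.Theorems.SchneiderFreeAdditiveX3.PoitouTateReduction.sumLocalTermEqZero_canonical
    (K := K) (p ^ k₄)
  have hcompl₂ := Summit.BirchSwinnertonDyer.BirchSwinnertonDyer.Theorems.SchneiderFreeAdditiveX3.PoitouTateReduction.selmerComplement_canonical_holds
    K (p ^ k₂)
  have hcompl₄ := Summit.BirchSwinnertonDyer.BirchSwinnertonDyer.Theorems.SchneiderFreeAdditiveX3.PoitouTateReduction.selmerComplement_canonical_holds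
    K (p ^ k₄)
  have hreal₂ : ∀ w' : InfinitePlace K, w'.IsReal →
      Injective (LocalInvariants.canonical K (p ^ k₂) (Sum.inl w')) := fun w' hw' ↦ by
    rw [LocalInvariants.canonical_inl]; exact archimedeanInvariantMap_injective_of_isReal hw'
  have hreal₄ : ∀ w' : InfinitePlace K, w'.IsReal →
      Injective (LocalInvariants.canonical K (p ^ k₄) (Sum.inl w')) := fun w' hw' ↦ by
    rw [LocalInvariants.canonical_inl]; exact archimedeanInvariantMap_injective_of_isReal hw'
  have hEuler₂ : ∀ v : HeightOneSpectrum (𝓞 K),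
      Nat.card (galoisCohomology ((W.torsionGaloisModule ((p ^ k₂ : ℕ) : ℤ)).toLocal (Sum.inr v)) 1) =
        (Nat.card (nsmulAddMonoidHom (p ^ k₂) :
            (W.baseChange (v.adicCompletion K)).toAffine.Point →+ _).ker *
          Nat.card (v.adicCompletionIntegers K ⧸
            Ideal.span {((p ^ k₂ : ℕ) : v.adicCompletionIntegers K)})) ^ 2 := fun v ↦ by
    haveI : CharZero (v.adicCompletion K) := Literature.NumberTheory.GaloisRepresentations.charZero_adicCompletion v
    exact natCard_galoisCohomology_one_torsion_adicCompletion_eq_sq W v (p ^ k₂) hpp₂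
      (localEulerPoincareCharacteristic_holds (v.adicCompletion K))
  have hEuler₄ : ∀ v : HeightOneSpectrum (𝓞 K),
      Nat.card (galoisCohomology ((W.torsionGaloisModule ((p ^ k₄ : ℕ) : ℤ)).toLocal (Sum.inr v)) 1) =
        (Nat.card (nsmulAddMonoidHom (p ^ k₄) :
            (W.baseChange (v.adicCompletion K)).toAffine.Point →+ _).ker *
          Nat.card (v.adicCompletionIntegers K ⧸
            Ideal.span {((p ^ k₄ : ℕ) : v.adicCompletionIntegers K)})) ^ 2 := fun v ↦ by
    haveI : CharZero (v.adicCompletion K) := Literature.NumberTheory.GaloisRepresentations.charZero_adicCompletion v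
    exact natCard_galoisCohomology_one_torsion_adicCompletion_eq_sq W v (p ^ k₄) hpp₄
      (localEulerPoincareCharacteristic_holds (v.adicCompletion K))
  -- the two relaxed counts and the two maximal-isotropic counts
  set M₂ : ∀ u : ↥T, AddSubgroup (galoisCohomology ((W.torsionGaloisModule ((p ^ k₂ : ℕ) : ℤ)).toLocal (u : Place K)) 1) :=
    fun _ ↦ ⊤ with hM₂
  have h4 := natCard_solutions_mul_eq_kummerOutside W p k₄ e₄ hμ₄ hadd₁₄ hadd₂₄ hgal₄ halt₄ hnondeg₄ hperf₄ hsum₄ hcompl₄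
    hEuler₄ hreal₄ T loc₄ hloc₄ M
  have h2 := natCard_solutions_mul_eq_kummerOutside W p k₂ e₂ hμ₂ hadd₁₂ hadd₂₂ hgal₂ halt₂ hnondeg₂ hperf₂ hsum₂ hcompl₂
    hEuler₂ hreal₂ T loc₂ hloc₂ M₂
  have hG4 := natCard_map_kummerOutside_sq_places W p k₄ e₄ hμ₄ hadd₁₄ hadd₂₄ hgal₄ halt₄ hnondeg₄ hperf₄ hsum₄ hcompl₄
    hEuler₄ hreal₄ T loc₄ hloc₄
  have hG2 := natCard_map_kummerOutside_sq_places W p k₂ e₂ hμ₂ hadd₁₂ hadd₂₂ hgal₂ halt₂ hnondeg₂ hperf₂ hsum₂ hcompl₂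
    hEuler₂ hreal₂ T loc₂ hloc₂
  rw [← Finset.prod_coe_sort T] at hG4 hG2
  -- `m₂ = ∏ #H¹(K_u, E[p^{k₂}])`
  have hm₂ : (∏ u : ↥T, Nat.card (M₂ u)) =
      ∏ u : ↥T, Nat.card (galoisCohomology ((W.torsionGaloisModule ((p ^ k₂ : ℕ) : ℤ)).toLocal (u : Place K)) 1) :=
    Finset.prod_congr rfl fun u _ ↦ by rw [hM₂]; exact AddSubgroup.card_top
  rw [hm₂] at h2
  -- finiteness of the solution groups
  have hfinKO₂ : Finite (kummerOutside W (p ^ k₂) T) :=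
    Summit.BirchSwinnertonDyer.Rank1Residual.X11b.SelmerLevelBound.finite_kummerOutside W (p ^ k₂) T
  have hfinKO₄ : Finite (kummerOutside W (p ^ k₄) T) :=
    Summit.BirchSwinnertonDyer.Rank1Residual.X11b.SelmerLevelBound.finite_kummerOutside W (p ^ k₄) T
  haveI : Finite ↥(kummerOutside W (p ^ k₂) T ⊓ (AddSubgroup.pi Set.univ M₂).comap loc₂) :=
    Finite.of_injective _ (AddSubgroup.inclusion_injective (inf_le_left : kummerOutside W (p ^ k₂) T ⊓ _ ≤ _))
  haveI : Finite ↥(kummerOutside W (p ^ k₄) T ⊓ (AddSubgroup.pi Set.univ M).comap loc₄) :=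
    Finite.of_injective _ (AddSubgroup.inclusion_injective (inf_le_left : kummerOutside W (p ^ k₄) T ⊓ _ ≤ _))
  haveI : Finite ↥(kummerOutside W (p ^ k₄) T ⊓ (AddSubgroup.pi Set.univ (fun u : ↥T ↦
      annLeft (invWeilPairing W (p ^ k₄) e₄ hμ₄ hadd₁₄ hadd₂₄ hgal₄ (LocalInvariants.canonical K (p ^ k₄)) (u : Place K))
        (M u))).comap loc₄) :=
    Finite.of_injective _ (AddSubgroup.inclusion_injective (inf_le_left : kummerOutside W (p ^ k₄) T ⊓ _ ≤ _))
  refine exists_nsmul_not_mem_of_counts q ι hι _ _ _ _ h4 h2 ?_ ?_ B ?_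
  · -- `q`-torsion of `𝒴₄` comes from level `p^{k₂}`
    rintro y ⟨hyKO, -⟩ hqy
    obtain ⟨c, hc, rfl⟩ := htors y hyKO hqy
    exact ⟨c, ⟨hc, (AddSubgroup.mem_comap).mpr ((AddSubgroup.mem_pi _).mpr fun u _ ↦ by
      rw [hM₂]; exact AddSubgroup.mem_top _)⟩, rfl⟩
  · -- `ι(𝒴₂*) ≤ 𝒴₄*`
    rintro _ ⟨c, ⟨hcKO, hc0⟩, rfl⟩
    refine ⟨hKO c hcKO, (AddSubgroup.mem_comap).mpr ((AddSubgroup.mem_pi _).mpr fun u _ ↦ ?_)⟩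
    have hcu : loc₂ c u ∈ annLeft (invWeilPairing W (p ^ k₂) e₂ hμ₂ hadd₁₂ hadd₂₂ hgal₂ (LocalInvariants.canonical K (p ^ k₂))
        (u : Place K)) (M₂ u) := (AddSubgroup.mem_pi _).mp ((AddSubgroup.mem_comap).mp hc0) u (Set.mem_univ _)
    have hzero : loc₂ c u = 0 := by
      apply (invWeilPairing_bijective_place W (p ^ k₂) e₂ hμ₂ hadd₁₂ hadd₂₂ hgal₂ halt₂ hnondeg₂
        (LocalInvariants.canonical K (p ^ k₂)) hperf₂ hreal₂ (u : Place K)).1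
      ext x
      rw [map_zero, AddMonoidHom.zero_apply]
      exact (mem_annLeft_iff _ _ _).mp hcu x (by rw [hM₂]; exact AddSubgroup.mem_top _)
    have h0 : loc₄ (ι c) u = 0 := hloc0 c u hzero
    change loc₄ (ι c) u ∈ _
    rw [h0]
    exact AddSubgroup.zero_mem _
  · -- the numerical hypothesis, squared: `(#B m₂ g₄)² = #B²(∏#H¹₂)²∏#H¹₄ < (∏#M)²∏#H¹₂ = (m₄ g₂)²`
    have hpos₂ : 0 < ∏ u : ↥T, Nat.card (galoisCohomology ((W.torsionGaloisModule ((p ^ k₂ : ℕ) : ℤ)).toLocal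
        (u : Place K)) 1) := Finset.prod_pos fun u _ ↦ Nat.card_pos
    refine (Nat.pow_lt_pow_iff_left two_ne_zero).mp ?_
    rw [mul_pow, mul_pow, mul_pow, hG4, hG2]
    calc B.card ^ 2 *
          (∏ u : ↥T, Nat.card (galoisCohomology ((W.torsionGaloisModule ((p ^ k₂ : ℕ) : ℤ)).toLocal (u : Place K)) 1)) ^ 2 *
          ∏ u : ↥T, Nat.card (galoisCohomology ((W.torsionGaloisModule ((p ^ k₄ : ℕ) : ℤ)).toLocal (u : Place K)) 1)
        = B.card ^ 2 *
            ((∏ u : ↥T, Nat.card (galoisCohomology ((W.torsionGaloisModule ((p ^ k₂ : ℕ) : ℤ)).toLocal (u : Place K)) 1)) *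
              ∏ u : ↥T, Nat.card (galoisCohomology ((W.torsionGaloisModule ((p ^ k₄ : ℕ) : ℤ)).toLocal (u : Place K)) 1)) *
          ∏ u : ↥T, Nat.card (galoisCohomology ((W.torsionGaloisModule ((p ^ k₂ : ℕ) : ℤ)).toLocal (u : Place K)) 1) := by
          ring
      _ < (∏ u : ↥T, Nat.card (M u)) ^ 2 *
          ∏ u : ↥T, Nat.card (galoisCohomology ((W.torsionGaloisModule ((p ^ k₂ : ℕ) : ℤ)).toLocal (u : Place K)) 1) :=
          Nat.mul_lt_mul_of_pos_right hlt hpos₂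

end TwoLevel

end Summit.BirchSwinnertonDyer.BirchSwinnertonDyer.Theorems.GenusExact.RelaxedCount

end
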